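import Summits.RiemannHypothesis.RiemannHypothesis.Theorems.GroundBartaPolarPerronFrobeniusEvenGain
import HarnessLib

/-!
# RiemannHypothesis / GroundBarta — crux `PolarPerronFrobenius` (stmt-RiemannHypothesis-18390):
# even-sector sign improvement, part E2b: Fubini, translation and reflection identities

Helper file (`--supports stmt-RiemannHypothesis-18390`), RH-free, Mathlib + proved tree files only,
no definitions, no named facts.  Notation as in part E2a (`p = f⁺`, `n = f⁻`, `k(t) = min(w(|t|),5)`):

* `swe_gain_fubini`: `∫ k(t)·(4∫ n(x)(p(x+t)+p(x−t))dx) dt = 4∫ n(x)·(∫ k(t)(p(x+t)+p(x−t))dt) dx`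
  (the integrand on `ℝ²` is dominated by `2‖f‖_∞ · k(t) n(x)`, a product of integrable functions);
* `swe_integrable_marginal`: the resulting `x`-integrand is integrable;
* `swe_inner_eq`: `∫ k(t)(p(x+t) + p(x−t)) dt = 2∫ k(x−y) p(y) dy`; for EVEN `f`,
  `swe_inner_even`: `2∫ k(x−y)p(y)dy = ∫ (k(x−y) + k(x+y)) p(y) dy`;
* `swe_two_mul_gain_eq`: `2∫_{(0,∞)} min(w,5)·G = ∫_ℝ k·G` for even `G`.

Prover B, speedrun unit `sr-gb-rung-b` (seat 2).
-/

set_option linter.dupNamespace false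

noncomputable section

open Set MeasureTheory Filter Complex
open scoped Real Topology

namespace Summit.RiemannHypothesis.RiemannHypothesis.Theorems.PolarPerronFrobenius

open Literature.NumberTheory.LFunctions

/-! ## Fubini: the gain as an `x`-integral of a `y`-convolution -/

section Fubini

variable {f : ℝ → ℝ}

/-- **Fubini for the truncated gain.**
`∫ k(t)·(4∫ f⁻(x)(f⁺(x+t) + f⁺(x−t)) dx) dt = 4∫ f⁻(x)·(∫ k(t)(f⁺(x+t) + f⁺(x−t)) dt) dx`
(the integrand on `ℝ²` is dominated by `8‖f‖_∞ · k(t) f⁻(x)`, a product of integrable functions).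
[folklore] -/
theorem swe_gain_fubini (hfc : Continuous f) (hfs : HasCompactSupport f) :
    ∫ t, min (weilArchDensity |t|) 5 * (4 * ∫ x, max (-f x) 0 * (max (f (x + t)) 0 + max (f (x - t)) 0)) =
      4 * ∫ x, max (-f x) 0 *
        ∫ t, min (weilArchDensity |t|) 5 * (max (f (x + t)) 0 + max (f (x - t)) 0) := by
  have hp : Continuous fun x ↦ max (f x) 0 := hfc.max continuous_const
  have hn : Continuous fun x ↦ max (-f x) 0 := hfc.neg.max continuous_const
  have hns := swe_hasCompactSupport_negPart hfs
  obtain ⟨C, hC0, hC⟩ := swe_exists_bound hfc hfs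
  -- the integrand on `ℝ × ℝ`, variables `(t, x)`
  set Φ : ℝ → ℝ → ℝ := fun t x ↦
    min (weilArchDensity |t|) 5 * (max (-f x) 0 * (max (f (x + t)) 0 + max (f (x - t)) 0)) with hΦ
  have hmeas : AEStronglyMeasurable (Function.uncurry Φ) (volume.prod volume) := by
    refine Measurable.aestronglyMeasurable ?_
    have m1 : Measurable fun q : ℝ × ℝ ↦ min (weilArchDensity |q.1|) 5 :=
      swe_measurable_truncKernel.comp measurable_fst
    have m2 : Measurable fun q : ℝ × ℝ ↦ max (-f q.2) 0 := hn.measurable.comp measurable_snd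
    have m3 : Measurable fun q : ℝ × ℝ ↦ max (f (q.2 + q.1)) 0 :=
      hp.measurable.comp (measurable_snd.add measurable_fst)
    have m4 : Measurable fun q : ℝ × ℝ ↦ max (f (q.2 - q.1)) 0 :=
      hp.measurable.comp (measurable_snd.sub measurable_fst)
    exact m1.mul (m2.mul (m3.add m4))
  have hdom : Integrable (fun q : ℝ × ℝ ↦ (2 * C) * (min (weilArchDensity |q.1|) 5 * max (-f q.2) 0))
      (volume.prod volume) :=
    (swe_integrable_truncKernel.mul_prod (hn.integrable_of_hasCompactSupport hns)).const_mul (2 * C)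
  have hint : Integrable (Function.uncurry Φ) (volume.prod volume) := by
    refine hdom.mono' hmeas (Eventually.of_forall fun q ↦ ?_)
    simp only [Function.uncurry, hΦ]
    have hk0 := swe_truncKernel_nonneg q.1
    have hn0 : 0 ≤ max (-f q.2) 0 := le_max_right _ _
    have hp1 : max (f (q.2 + q.1)) 0 ≤ C := max_le ((le_abs_self _).trans (hC _)) hC0
    have hp2 : max (f (q.2 - q.1)) 0 ≤ C := max_le ((le_abs_self _).trans (hC _)) hC0
    have hp1' : 0 ≤ max (f (q.2 + q.1)) 0 := le_max_right _ _
    have hp2' : 0 ≤ max (f (q.2 - q.1)) 0 := le_max_right _ _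
    rw [Real.norm_of_nonneg (mul_nonneg hk0 (mul_nonneg hn0 (add_nonneg hp1' hp2')))]
    nlinarith [mul_nonneg hk0 hn0]
  have hswap := integral_integral_swap hint
  -- left side: pull the constant in
  have hL : ∫ t, min (weilArchDensity |t|) 5 *
      (4 * ∫ x, max (-f x) 0 * (max (f (x + t)) 0 + max (f (x - t)) 0)) = 4 * ∫ t, ∫ x, Φ t x := by
    rw [← integral_const_mul (4 : ℝ) (fun t ↦ ∫ x, Φ t x)]
    refine integral_congr_ae (Eventually.of_forall fun t ↦ ?_)
    simp only [hΦ]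
    rw [integral_const_mul (min (weilArchDensity |t|) 5)]
    ring
  have hR : ∫ x, max (-f x) 0 * ∫ t, min (weilArchDensity |t|) 5 * (max (f (x + t)) 0 + max (f (x - t)) 0) =
      ∫ x, ∫ t, Φ t x := by
    refine integral_congr_ae (Eventually.of_forall fun x ↦ ?_)
    simp only [hΦ]
    rw [← integral_const_mul (max (-f x) 0)]
    refine integral_congr_ae (Eventually.of_forall fun t ↦ ?_)
    simp only
    ring
  rw [hL, hR, hswap]

/-- The `x`-marginal is integrable: `x ↦ f⁻(x) ∫ k(t)(f⁺(x+t)+f⁺(x−t)) dt` (for the final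
`integral_mono`). [folklore] -/
theorem swe_integrable_marginal (hfc : Continuous f) (hfs : HasCompactSupport f) :
    Integrable fun x ↦ max (-f x) 0 *
      ∫ t, min (weilArchDensity |t|) 5 * (max (f (x + t)) 0 + max (f (x - t)) 0) := by
  have hp : Continuous fun x ↦ max (f x) 0 := hfc.max continuous_const
  have hn : Continuous fun x ↦ max (-f x) 0 := hfc.neg.max continuous_const
  have hns := swe_hasCompactSupport_negPart hfs
  obtain ⟨C, hC0, hC⟩ := swe_exists_bound hfc hfs
  -- the inner integral is bounded by `2C ∫ k`
  have hbd : ∀ x, |∫ t, min (weilArchDensity |t|) 5 * (max (f (x + t)) 0 + max (f (x - t)) 0)| ≤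
      2 * C * ∫ t, min (weilArchDensity |t|) 5 := by
    intro x
    rw [← integral_const_mul (2 * C)]
    refine (abs_integral_le_integral_abs).trans (integral_mono_of_nonneg
      (Eventually.of_forall fun t ↦ abs_nonneg _) (swe_integrable_truncKernel.const_mul _)
      (Eventually.of_forall fun t ↦ ?_))
    have hk0 := swe_truncKernel_nonneg t
    have hp1 : max (f (x + t)) 0 ≤ C := max_le ((le_abs_self _).trans (hC _)) hC0
    have hp2 : max (f (x - t)) 0 ≤ C := max_le ((le_abs_self _).trans (hC _)) hC0
    have hp1' : 0 ≤ max (f (x + t)) 0 := le_max_right _ _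
    have hp2' : 0 ≤ max (f (x - t)) 0 := le_max_right _ _
    simp only
    rw [abs_of_nonneg (mul_nonneg hk0 (add_nonneg hp1' hp2'))]
    nlinarith
  have hmeas : AEStronglyMeasurable
      (fun x ↦ ∫ t, min (weilArchDensity |t|) 5 * (max (f (x + t)) 0 + max (f (x - t)) 0)) volume := by
    have m : Measurable (Function.uncurry fun x t ↦
        min (weilArchDensity |t|) 5 * (max (f (x + t)) 0 + max (f (x - t)) 0)) := by
      have m1 : Measurable fun q : ℝ × ℝ ↦ min (weilArchDensity |q.2|) 5 :=
        swe_measurable_truncKernel.comp measurable_snd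
      have m3 : Measurable fun q : ℝ × ℝ ↦ max (f (q.1 + q.2)) 0 :=
        hp.measurable.comp (measurable_fst.add measurable_snd)
      have m4 : Measurable fun q : ℝ × ℝ ↦ max (f (q.1 - q.2)) 0 :=
        hp.measurable.comp (measurable_fst.sub measurable_snd)
      exact m1.mul (m3.add m4)
    exact m.stronglyMeasurable.integral_prod_right'.aestronglyMeasurable
  refine Integrable.mono' ((hn.integrable_of_hasCompactSupport hns).norm.mul_const
    (2 * C * ∫ t, min (weilArchDensity |t|) 5)) ((hn.aestronglyMeasurable).mul hmeas)
    (Eventually.of_forall fun x ↦ ?_)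
  rw [norm_mul, Real.norm_eq_abs, Real.norm_eq_abs]
  exact mul_le_mul_of_nonneg_left (hbd x) (abs_nonneg _)

end Fubini

/-! ## The inner integral as a `y`-convolution; reflection for even `f` -/

section Inner

variable {f : ℝ → ℝ}

/-- `∫ k(t)(f⁺(x+t) + f⁺(x−t)) dt = 2 ∫ k(x−y) f⁺(y) dy` (translate each piece; `k` is even).
[folklore] -/
theorem swe_inner_eq (hfc : Continuous f) (hfs : HasCompactSupport f) (x : ℝ) :
    ∫ t, min (weilArchDensity |t|) 5 * (max (f (x + t)) 0 + max (f (x - t)) 0) =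
      2 * ∫ y, min (weilArchDensity |x - y|) 5 * max (f y) 0 := by
  have hp : Continuous fun x ↦ max (f x) 0 := hfc.max continuous_const
  have hps := swe_hasCompactSupport_posPart hfs
  -- integrability of `y ↦ k(x - y) f⁺(y)`-type functions (bounded kernel × compactly supported)
  have hint : ∀ g : ℝ → ℝ, Measurable g → (∀ t, |g t| ≤ 5) →
      Integrable fun t ↦ g t * max (f (x + t)) 0 := by
    intro g hg hg5
    have hc : Integrable fun t ↦ max (f (x + t)) 0 :=
      (hp.comp (continuous_const.add continuous_id)).integrable_of_hasCompactSupport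
        (hps.comp_homeomorph (Homeomorph.addLeft x))
    refine Integrable.mono' (hc.norm.const_mul 5) (hg.aestronglyMeasurable.mul hc.aestronglyMeasurable)
      (Eventually.of_forall fun t ↦ ?_)
    rw [norm_mul, Real.norm_eq_abs, Real.norm_eq_abs]
    exact mul_le_mul_of_nonneg_right (hg5 t) (abs_nonneg _)
  have hint' : ∀ g : ℝ → ℝ, Measurable g → (∀ t, |g t| ≤ 5) →
      Integrable fun t ↦ g t * max (f (x - t)) 0 := by
    intro g hg hg5
    have hc : Integrable fun t ↦ max (f (x - t)) 0 :=
      (hp.comp (continuous_const.sub continuous_id)).integrable_of_hasCompactSupport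
        (hps.comp_homeomorph ((Homeomorph.neg ℝ).trans (Homeomorph.addLeft x)))
    refine Integrable.mono' (hc.norm.const_mul 5) (hg.aestronglyMeasurable.mul hc.aestronglyMeasurable)
      (Eventually.of_forall fun t ↦ ?_)
    rw [norm_mul, Real.norm_eq_abs, Real.norm_eq_abs]
    exact mul_le_mul_of_nonneg_right (hg5 t) (abs_nonneg _)
  have hk5 : ∀ t : ℝ, |min (weilArchDensity |t|) 5| ≤ 5 := fun t ↦ by
    rw [abs_of_nonneg (swe_truncKernel_nonneg t)]
    exact swe_truncKernel_le t
  have i1 := hint _ swe_measurable_truncKernel hk5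
  have i2 := hint' _ swe_measurable_truncKernel hk5
  -- `∫ k(t) f⁺(x+t) dt = ∫ k(y - x) f⁺(y) dy = ∫ k(x - y) f⁺(y) dy`
  have e1 : ∫ t, min (weilArchDensity |t|) 5 * max (f (x + t)) 0 =
      ∫ y, min (weilArchDensity |x - y|) 5 * max (f y) 0 := by
    have h := integral_add_right_eq_self (μ := volume)
      (fun y ↦ min (weilArchDensity |x - y|) 5 * max (f y) 0) x
    rw [← h]
    refine integral_congr_ae (Eventually.of_forall fun t ↦ ?_)
    simp only
    rw [show x - (t + x) = -t by ring, abs_neg, add_comm t x]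
  -- `∫ k(t) f⁺(x-t) dt = ∫ k(x - y) f⁺(y) dy`
  have e2 : ∫ t, min (weilArchDensity |t|) 5 * max (f (x - t)) 0 =
      ∫ y, min (weilArchDensity |x - y|) 5 * max (f y) 0 := by
    have h := integral_sub_left_eq_self (fun y ↦ min (weilArchDensity |x - y|) 5 * max (f y) 0)
      volume x
    rw [← h]
    refine integral_congr_ae (Eventually.of_forall fun t ↦ ?_)
    simp only
    rw [show x - (x - t) = t by ring]
  calc ∫ t, min (weilArchDensity |t|) 5 * (max (f (x + t)) 0 + max (f (x - t)) 0)
      = ∫ t, (min (weilArchDensity |t|) 5 * max (f (x + t)) 0 +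
          min (weilArchDensity |t|) 5 * max (f (x - t)) 0) := by
        refine integral_congr_ae (Eventually.of_forall fun t ↦ ?_); simp only; ring
    _ = (∫ t, min (weilArchDensity |t|) 5 * max (f (x + t)) 0) +
          ∫ t, min (weilArchDensity |t|) 5 * max (f (x - t)) 0 := integral_add i1 i2
    _ = 2 * ∫ y, min (weilArchDensity |x - y|) 5 * max (f y) 0 := by rw [e1, e2]; ring

/-- **Reflection for even `f`**: `2∫ k(x−y) f⁺(y) dy = ∫ (k(x−y) + k(x+y)) f⁺(y) dy`. [folklore] -/
theorem swe_inner_even (hfc : Continuous f) (hfs : HasCompactSupport f) (hfe : ∀ t, f (-t) = f t)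
    (x : ℝ) :
    2 * ∫ y, min (weilArchDensity |x - y|) 5 * max (f y) 0 =
      ∫ y, (min (weilArchDensity |x - y|) 5 + min (weilArchDensity |x + y|) 5) * max (f y) 0 := by
  have hp : Continuous fun x ↦ max (f x) 0 := hfc.max continuous_const
  have hps := swe_hasCompactSupport_posPart hfs
  have hc : Integrable fun y ↦ max (f y) 0 := hp.integrable_of_hasCompactSupport hps
  have hint : ∀ g : ℝ → ℝ, Measurable g → (∀ t, |g t| ≤ 5) →
      Integrable fun y ↦ g y * max (f y) 0 := by
    intro g hg hg5
    refine Integrable.mono' (hc.norm.const_mul 5) (hg.aestronglyMeasurable.mul hc.aestronglyMeasurable)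
      (Eventually.of_forall fun t ↦ ?_)
    rw [norm_mul, Real.norm_eq_abs, Real.norm_eq_abs]
    exact mul_le_mul_of_nonneg_right (hg5 t) (abs_nonneg _)
  have hk5 : ∀ s : ℝ, |min (weilArchDensity |s|) 5| ≤ 5 := fun s ↦ by
    rw [abs_of_nonneg (swe_truncKernel_nonneg s)]
    exact swe_truncKernel_le s
  have m1 : Measurable fun y : ℝ ↦ min (weilArchDensity |x - y|) 5 :=
    swe_measurable_truncKernel.comp (measurable_const.sub measurable_id)
  have m2 : Measurable fun y : ℝ ↦ min (weilArchDensity |x + y|) 5 :=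
    swe_measurable_truncKernel.comp (measurable_const.add measurable_id)
  have i1 := hint _ m1 (fun y ↦ hk5 _)
  have i2 := hint _ m2 (fun y ↦ hk5 _)
  -- reflection `y ↦ -y`
  have e : ∫ y, min (weilArchDensity |x - y|) 5 * max (f y) 0 =
      ∫ y, min (weilArchDensity |x + y|) 5 * max (f y) 0 := by
    have h := integral_neg_eq_self (fun y ↦ min (weilArchDensity |x - y|) 5 * max (f y) 0) volume
    rw [← h]
    refine integral_congr_ae (Eventually.of_forall fun y ↦ ?_)
    simp only
    rw [sub_neg_eq_add, hfe]
  rw [two_mul]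
  nth_rewrite 2 [e]
  rw [← integral_add i1 i2]
  refine integral_congr_ae (Eventually.of_forall fun y ↦ ?_)
  simp only
  ring

end Inner

/-! ## From `(0, ∞)` to `ℝ` -/

/-- For an even `G`: `2∫_{(0,∞)} min(w(t),5) G(t) dt = ∫_ℝ min(w(|t|),5) G(t) dt`
(`integral_comp_abs`). [folklore] -/
theorem swe_two_mul_gain_eq {G : ℝ → ℝ} (hG : ∀ t, G (-t) = G t) :
    2 * ∫ t in Ioi (0 : ℝ), min (weilArchDensity t) 5 * G t =
      ∫ t, min (weilArchDensity |t|) 5 * G t := by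
  have h := integral_comp_abs (f := fun s ↦ min (weilArchDensity s) 5 * G s)
  rw [← h]
  refine integral_congr_ae (Eventually.of_forall fun t ↦ ?_)
  simp only
  congr 1
  rcases le_total 0 t with ht | ht
  · rw [abs_of_nonneg ht]
  · rw [abs_of_nonpos ht, hG]

end Summit.RiemannHypothesis.RiemannHypothesis.Theorems.PolarPerronFrobenius

end
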